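import Summits.KontsevichZagierPeriods.KontsevichZagierPeriods.Theorems.HurwitzMicroSectorsNormalFormPrincipleL2W3Carriers
import Summits.KontsevichZagierPeriods.KontsevichZagierPeriods.Theorems.HurwitzMicroSectorsNormalFormPrincipleL2W3ExistsChartTargets
import Summits.KontsevichZagierPeriods.KontsevichZagierPeriods.Theorems.HurwitzMicroSectorsNormalFormPrincipleM3EbdBoxSubSimplex
import Summits.KontsevichZagierPeriods.KontsevichZagierPeriods.Theorems.HurwitzMicroSectorsNormalFormPrincipleL2W3RelationsDilation
import Summits.KontsevichZagierPeriods.KontsevichZagierPeriods.Theorems.HurwitzMicroSectorsNormalFormPrincipleL2W3RelationsMoebiusOne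
import Summits.KontsevichZagierPeriods.KontsevichZagierPeriods.Theorems.HurwitzMicroSectorsNormalFormPrincipleL2W3RelationsMoebiusTwo
import Summits.KontsevichZagierPeriods.KontsevichZagierPeriods.Theorems.HurwitzMicroSectorsNormalFormPrincipleL2W3RelationsMoebiusThree
import Summits.KontsevichZagierPeriods.KontsevichZagierPeriods.Theorems.HurwitzMicroSectorsNormalFormPrincipleL2W3RelationsReflection

/-!
# `NormalFormPrinciple` (stmt-KontsevichZagierPeriods-3869), line `SketchIdeator1` —
# leaf `stub_boxRigidity` in DIMENSION THREE: FiveEighthsZetaThree `[(0,1)³, 8/((1+xy)(1+xyz))] ∼ [(0,1)³, 5/(1−xyz)]`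

Assembly file (layer `L2W3`, lead seat c9; `--supports` the crux) of the third target of the crux idea
`m3-equal-value-instances` (strategist gen 2). Both sides are box-rational with EQUAL values
(`8·∫dV/((1+xy)(1+xyz)) = 8(∫aac − ∫acc) = 8(¾ − ⅛)ζ(3) = 5ζ(3)`, alternating double Euler sums), and
the relation is NOT generated by integrand identities / dilations of the box / box symmetries /
polynomial primitives (N9). The chain ("level-2 weight-3 descent"): the simplex chart turns the boxes
into `ℤ`-combinations of weight-3 word representations `[Δ, x(t₀)y(t₁)z(t₂)]` in the letters
`a = dt/t`, `b = dt/(1−t)`, `c = dt/(1+t)`; the DILATION `t ↦ t²` of `Δ` (distribution: `a ↦ 2a`,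
`b ↦ b − c`), the MÖBIUS involution `t ↦ (1−t)/(1+t)` (order-reversing; `a ↦ b + c`, `b ↦ a − c`,
`c ↦ c`) and the REFLECTION `t ↦ 1 − t` (duality) are single rule-(2) moves, and five of them
(`rel1`–`rel5` of the layer's relation packages) combine with integer coefficients
`−1, −2, −4, −4, 6` to `8[aac] − 8[acc] − 5[aab]`. No shuffle and no independence input is used.
Sources: M. Kontsevich, D. Zagier, *Periods* (2001), §1.2; J. M. Borwein, D. M. Bradley,
D. J. Broadhurst, *Evaluations of k-fold Euler/Zagier sums* (1997), §4 (alternating weight-3 sums).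
No definitions are introduced.
-/

noncomputable section

open MeasureTheory Set
open Literature.NumberTheory.Transcendental Literature.NumberTheory.Transcendental.KZ
open Literature.ModelTheory.ExponentialFields (IsSemialgebraic)
open Summit.KontsevichZagierPeriods.HyperbolicBloch.OffTetraSectorKernel
  (aff_orbit_of_sub_sum_zsmul_mem_relations)

namespace Summit.KontsevichZagierPeriods.HurwitzMicroSectors.NormalFormPrinciple.PiBox.M3

/-- **FiveEighthsZetaThree (`StrategistGen2.FiveEighthsZetaThree`, crux idea
`m3-equal-value-instances`; registered sub-goal of stmt-KontsevichZagierPeriods-3869, line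
`SketchIdeator1`, layer `L2W3`).** Any representation of `[(0,1)³, 8/((1+xy)(1+xyz))]` is
KZ-equivalent to any representation of `[(0,1)³, 5/(1−xyz)]` (`8·Σ alternating = 5ζ(3)`): an
instance of the leaf `stub_boxRigidity` in dimension three, both sides box-rational, no
transcendence input — proved by the level-2 weight-3 descent (box charts, two dilation moves, two
Möbius moves, one duality move, integrand additivity; bookkeeping
`8[aac] − 8[acc] − 5[aab] = −rel1 − 2rel2 − 4rel3 − 4rel4 + 6rel5`).
[cite: KontsevichZagier2001, §1.2 rules (1), (2)] -/
theorem fiveEighthsZetaThree (r r' : IntegralRep 3)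
    (hrd : r.domain = {x | ∀ i, x i ∈ Set.Ioo (0:ℝ) 1})
    (hri : EqOn r.integrand (fun x => 8 / ((1 + x 0 * x 1) * (1 + x 0 * x 1 * x 2))) {x | ∀ i, x i ∈ Set.Ioo (0:ℝ) 1})
    (hr'd : r'.domain = {x | ∀ i, x i ∈ Set.Ioo (0:ℝ) 1})
    (hr'i : EqOn r'.integrand (fun x => 5 / (1 - x 0 * x 1 * x 2)) {x | ∀ i, x i ∈ Set.Ioo (0:ℝ) 1}) :
    Equivalent r r' := by
  obtain ⟨AAB, ABB, AAC, ACC, ABC, ACB, CBB, CBC, CCB, CCC, CAB, CAC, AAD, DAD, ADD, DAB,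
    ⟨hAABd, hAABi⟩, ⟨hABBd, hABBi⟩, ⟨hAACd, hAACi⟩, ⟨hACCd, hACCi⟩, ⟨hABCd, hABCi⟩, ⟨hACBd, hACBi⟩,
    ⟨hCBBd, hCBBi⟩, ⟨hCBCd, hCBCi⟩, ⟨hCCBd, hCCBi⟩, ⟨hCCCd, hCCCi⟩, ⟨hCABd, hCABi⟩, ⟨hCACd, hCACi⟩,
    ⟨hAADd, hAADi⟩, ⟨hDADd, hDADi⟩, ⟨hADDd, hADDi⟩, ⟨hDABd, hDABi⟩⟩ := l2w3_carriers
  obtain ⟨⟨G1, hG1d, hG1i⟩, ⟨G2, hG2d, hG2i⟩, ⟨G3, hG3d, hG3i⟩, ⟨G4, hG4d, hG4i⟩, ⟨G5, hG5d, hG5i⟩,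
    ⟨G6, hG6d, hG6i⟩⟩ := l2w3_exists_chartTargets
  have e0 : of r - of G1 ∈ relations := by
    refine ebd_box_sub_simplex (fun t => 8 / (t 0 * t 1 * (1 + t 1) * (1 + t 2))) r G1 hrd hG1d
      (hG1i ▸ fun _ _ => rfl) fun x hx => ?_
    have hx' : ∀ i, x i ∈ Set.Ioo (0:ℝ) 1 := by rw [hrd] at hx; exact hx
    have h0 : x 0 ≠ 0 := (hx' 0).1.ne'
    have h1 : x 1 ≠ 0 := (hx' 1).1.ne'
    have h01 : 1 + x 0 * x 1 ≠ 0 := by nlinarith [(hx' 0).1, (hx' 1).1]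
    have h012 : 1 + x 0 * x 1 * x 2 ≠ 0 := by
      nlinarith [(hx' 0).1, (hx' 1).1, (hx' 2).1, mul_pos (hx' 0).1 (hx' 1).1]
    rw [hri hx']
    simp only [Matrix.cons_val_zero, Matrix.cons_val_one, Matrix.cons_val_two, Matrix.head_cons,
      Matrix.tail_cons]
    field_simp
  have e0' : of G1 - ((8:ℤ) • of AAC + (-8:ℤ) • of ACC) ∈ relations := by
    have h := aff_orbit_of_sub_sum_zsmul_mem_relations (Finset.univ : Finset (Fin 2))
      ![AAC, ACC] ![8, -8] G1 (fun i _ => by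
        fin_cases i
        · exact hAACd.trans hG1d.symm
        · exact hACCd.trans hG1d.symm) fun t ht => ?_
    · simpa [Fin.sum_univ_two, add_assoc] using h
    have hf := l2v_simplex_facts (hG1d ▸ ht)
    simp only [Fin.sum_univ_two, Matrix.cons_val_zero, Matrix.cons_val_one, hG1i, hAACi, hACCi]
    have h0 : t 0 ≠ 0 := hf.1.ne'
    have h0a : 1 - t 0 ≠ 0 := by linarith [hf.2.1]
    have h0b : 1 + t 0 ≠ 0 := by linarith [hf.1]
    have h0c : 2 - t 0 ≠ 0 := by linarith [hf.2.1]
    have h1 : t 1 ≠ 0 := hf.2.2.1.ne'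
    have h1a : 1 - t 1 ≠ 0 := by linarith [hf.2.2.2.1]
    have h1b : 1 + t 1 ≠ 0 := by linarith [hf.2.2.1]
    have h1c : 2 - t 1 ≠ 0 := by linarith [hf.2.2.2.1]
    have h2a : 1 - t 2 ≠ 0 := by linarith [hf.2.2.2.2.2]
    have h2b : 1 + t 2 ≠ 0 := by linarith [hf.2.2.2.2.1]
    have h2c : 2 - t 2 ≠ 0 := by linarith [hf.2.2.2.2.2]
    push_cast
    field_simp
    ring
  have e1 : of r' - of G2 ∈ relations := by
    refine ebd_box_sub_simplex (fun t => 5 / (t 0 * t 1 * (1 - t 2))) r' G2 hr'd hG2d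
      (hG2i ▸ fun _ _ => rfl) fun x hx => ?_
    have hx' : ∀ i, x i ∈ Set.Ioo (0:ℝ) 1 := by rw [hr'd] at hx; exact hx
    have h0 : x 0 ≠ 0 := (hx' 0).1.ne'
    have h1 : x 1 ≠ 0 := (hx' 1).1.ne'
    have h012m : 1 - x 0 * x 1 * x 2 ≠ 0 := by
      have := mul_lt_one_of_nonneg_of_lt_one_left (mul_pos (hx' 0).1 (hx' 1).1).le
        (mul_lt_one_of_nonneg_of_lt_one_left (hx' 0).1.le (hx' 0).2 (hx' 1).2.le) (hx' 2).2.le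
      exact (sub_pos.2 this).ne'
    rw [hr'i hx']
    simp only [Matrix.cons_val_zero, Matrix.cons_val_one, Matrix.cons_val_two, Matrix.head_cons,
      Matrix.tail_cons]
    field_simp
  have e1' : of G2 - ((5:ℤ) • of AAB) ∈ relations := by
    have h := aff_orbit_of_sub_sum_zsmul_mem_relations (Finset.univ : Finset (Fin 1))
      ![AAB] ![5] G2 (fun i _ => by fin_cases i; exact hAABd.trans hG2d.symm) fun t ht => ?_
    · simpa using h
    have hf := l2v_simplex_facts (hG2d ▸ ht)
    simp only [Finset.univ_unique, Fin.default_eq_zero, Finset.sum_singleton, Matrix.cons_val_zero,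
      hG2i, hAABi]
    have h0 : t 0 ≠ 0 := hf.1.ne'
    have h0a : 1 - t 0 ≠ 0 := by linarith [hf.2.1]
    have h0b : 1 + t 0 ≠ 0 := by linarith [hf.1]
    have h0c : 2 - t 0 ≠ 0 := by linarith [hf.2.1]
    have h1 : t 1 ≠ 0 := hf.2.2.1.ne'
    have h1a : 1 - t 1 ≠ 0 := by linarith [hf.2.2.2.1]
    have h1b : 1 + t 1 ≠ 0 := by linarith [hf.2.2.1]
    have h1c : 2 - t 1 ≠ 0 := by linarith [hf.2.2.2.1]
    have h2a : 1 - t 2 ≠ 0 := by linarith [hf.2.2.2.2.2]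
    have h2b : 1 + t 2 ≠ 0 := by linarith [hf.2.2.2.2.1]
    have h2c : 2 - t 2 ≠ 0 := by linarith [hf.2.2.2.2.2]
    push_cast
    field_simp
  have rel1 : (3:ℤ) • of AAB - (4:ℤ) • of AAC ∈ relations :=
    l2w3_relations_dilation.1 AAB hAABd hAABi AAC hAACd hAACi
  have rel2 : of ABB - (2:ℤ) • of ABC - (2:ℤ) • of ACB + (2:ℤ) • of ACC ∈ relations :=
    l2w3_relations_dilation.2 ABB hABBd hABBi ABC hABCd hABCi ACB hACBd hACBi ACC hACCd hACCi
  have rel3 : of CBB + of CBC + of CCB + of CCC - of AAC ∈ relations :=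
    l2w3_relations_moebius_one.1 AAC hAACd hAACi CBB hCBBd hCBBi CBC hCBCd hCBCi CCB hCCBd hCCBi CCC hCCCd hCCCi
  have rel4 : of ABB + of ABC + of ACB + of ACC - of CBB - of CBC - of CCB - of CCC - of AAB ∈ relations :=
    l2w3_relations_moebius_one.2 AAB hAABd hAABi ABB hABBd hABBi ABC hABCd hABCi ACB hACBd hACBi ACC hACCd hACCi
      CBB hCBBd hCBBi CBC hCBCd hCBCi CCB hCCBd hCCBi CCC hCCCd hCCCi
  have rel5 : of ABB - of AAB ∈ relations := l2w3_relations_reflection.1 AAB hAABd hAABi ABB hABBd hABBi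
  have key : ((8:ℤ) • of AAC + (-8:ℤ) • of ACC) - (5:ℤ) • of AAB =
      -((3:ℤ) • of AAB - (4:ℤ) • of AAC)
      - (2:ℤ) • (of ABB - (2:ℤ) • of ABC - (2:ℤ) • of ACB + (2:ℤ) • of ACC)
      - (4:ℤ) • (of CBB + of CBC + of CCB + of CCC - of AAC)
      - (4:ℤ) • (of ABB + of ABC + of ACB + of ACC - of CBB - of CBC - of CCB - of CCC - of AAB)
      + (6:ℤ) • (of ABB - of AAB) := by
    simp only [smul_sub, smul_add, neg_smul, smul_smul]
    norm_num
    abel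
  have hmid : ((8:ℤ) • of AAC + (-8:ℤ) • of ACC) - (5:ℤ) • of AAB ∈ relations := by
    rw [key]
    exact relations.add_mem (relations.sub_mem (relations.sub_mem (relations.sub_mem
      (relations.neg_mem rel1) (relations.zsmul_mem rel2 2)) (relations.zsmul_mem rel3 4))
      (relations.zsmul_mem rel4 4)) (relations.zsmul_mem rel5 6)
  have e : of r - of r' = (of r - of G1) + (of G1 - ((8:ℤ) • of AAC + (-8:ℤ) • of ACC))
      + (((8:ℤ) • of AAC + (-8:ℤ) • of ACC) - (5:ℤ) • of AAB) - (of G2 - (5:ℤ) • of AAB)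
      - (of r' - of G2) := by abel
  show of r - of r' ∈ relations
  rw [e]
  exact relations.sub_mem (relations.sub_mem (relations.add_mem (relations.add_mem e0 e0') hmid) e1') e1

end Summit.KontsevichZagierPeriods.HurwitzMicroSectors.NormalFormPrinciple.PiBox.M3
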